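import Summits.QuantumFields.BalabanUV.Beta.EriceFlowEnclosureB12AsPrintedPointwiseFadingLimitFloors
import Literature.MathematicalPhysics.QuantumFieldTheory.Balaban1983to89.B12Beta

/-!
# Beta / EriceFlowEnclosureB12AsPrintedPointwiseFadingLimitOneLoop — WHAT (0.31) FORCES, part 11e: THE ASYMPTOTIC CONSTANT IS THE LIMIT OF THE ONE-LOOP COEFFICIENTS.  With the
# PRINTED one-loop split `β_{k+1} = β⁰_{k+1} + β¹_{k+1}(g_0,…,g_k)` ([I] (2.12)–(2.14) p. 268, tree shape `B12Beta.OneLoopSplit`: `β¹` vanishes at `g_k = 0`) and the cell's corner bound (AF-1)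
# `|β¹_{k+1}(p)| ≤ C_r·p_k` on the boxes (row an4's letter; the gaps cell's `Spine/NE4/AsymptoticContent` input), the constant history `(δ,…,δ)` reads `|β_{k+1}(δ,…,δ) − β⁰_{k+1}| ≤ C_r δ`; part 11's
# sandwich `|β_{k+1}(δ,…,δ) − b⋆| ≤ 2Cδ∕(1−θ) + cθ^k∕(1−θ)` then gives, letting δ → 0⁺ at FIXED k, §1 **`abs_beta0_sub_bstar_le`**:
#   **`|β⁰_{k+1} − b⋆| ≤ cθ^k∕(1−θ)`  for EVERY k**
# — the one-loop coefficients converge to THE asymptotic constant at NE4's own geometric rate (`tendsto_beta0_bstar`).  So the limit `β⁰_∞` that the gaps cell's `AsymptoticContent.conv_of_scaleShiftRate`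
# produces from NE4 + (AF-1) (unnamed there: «∃ binf») IS part 11's `b⋆` (`limit_eq_bstar`: any geometric-rate limit of β⁰ equals b⋆) — the same number as `lim_{u→0⁺} betaInf β (u,u,…)`, the supremum of
# the eventual floors, the sharp (0.31) constant and the bare-coupling coefficient (parts 11–11d).  §2 on the as-printed carrier: `Theorem2Statement S hL` AS TYPED + `hrg` + node U2's letters + any
# printed-type split of `S.β` with the corner bound ⟹ **`oneBit_of_typedTheorem2`**: `β⁰_{k+1} → b⋆` AND `0 < b⋆` — i.e. the ONE BIT «`0 < lim_k β⁰_k`» to which the gaps cell's `Spine/NE4/LimitFormFromNE4`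
# reduces binder B3 (`DagBinding.EndpointExistence`) and [I] Thm 2 AS PRINTED (modulo the CAP sign list), given NE4 + (AF-1) + (C) + (U), is itself a CONSEQUENCE of Theorem 2 AS TYPED under node
# U2's moduli: on those hypotheses the TYPED reading already carries the sign of the one-loop limit (part 10b gave the eventual floor; this names the limit and its sign)
# (β-flow team, prover 2 = lower ∕ positivity side, unit `b2b-balaban-beta-bflow-p2`, gen 49; ROW AP-I × the printed one-loop split × the gaps cell's NE4 bookkeeping; junction)

HONEST FRAMING (page 1 of everything the β sub-cell writes): discharging `BetaPertH` makes Bałaban's UV stability UNCONDITIONAL — a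
real constructive-QFT result; it is NOT the continuum limit and NOT the Clay problem.  HONEST DEPENDENCY (cell reorg 2026-08-19,
verbatim): «continuum YM on T⁴ ⇐ BetaPertH ∧ nine spine estimates (0/9 proved); BetaPertH ⇐ (D1) ∧ (D4) ∧ CAP+tail; G-an2-4 gates
asym, D1 and NE2/3/4.»  THIS MODULE DISCHARGES NOTHING: [folklore] limit calculus for an ABSTRACT `β : FlowStep.HBeta` with a DISPLAYED split `T : B12Beta.OneLoopSplit β` (the printed SHAPE of
(2.12)–(2.14); which numbers β⁰_{k+1} Bałaban's construction produces is NOT used), under LETTERS displayed as hypotheses: the corner bound (AF-1) (p. 264 clause made quantitative and k-uniform —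
UNPRINTED uniformity, GAPS G-adv2-3 ∕ G-b12-2), node U2's `HistLipschitz ∕ FadingMemory ∕ ScaleShiftRate` (NOT printed: p. 298 ∕ p. 264; G-t4-U2-1∕2), and in §2 the NAMED FIELDS of `B12BetaAsPrinted`
(`Theorem2Statement` STATED WITHOUT PROOF p. 259 — a HYPOTHESIS) with `hrg`.  (AF-0r) ∕ (AF-0∞) (rows an1∕an2∕an3∕an5, GAPS G-an2-4) are NOT discharged: they are DERIVED here only from the listed
letters, none of which is printed.  `b⋆` is a real with a displayed property.  Nothing of Bałaban's (1.22) ∕ one-loop coefficients is asserted.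

WHAT THIS FILE PROVES (0 sorry, 0 def): §1 `abs_const_sub_beta0_le` (`|β_{k+1}(δ,…,δ) − β⁰_{k+1}| ≤ C_r δ`), **`abs_beta0_sub_bstar_le`** (`|β⁰_{k+1} − b⋆| ≤ cθ^k∕(1−θ)`), **`tendsto_beta0_bstar`**,
**`limit_eq_bstar`** (any geometric-rate limit of β⁰ is b⋆), `beta0_eventually_pos` (`b⋆ > 0 ⟹ β⁰_{k+1} ≥ b⋆∕2` past a threshold); §2 **`oneBit_of_typedTheorem2`**, `oneBit_of_typedTheorem2'` (`hrg` from
`Definitions` + (U)).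
NOT CLAIMED: the value or sign of Bałaban's one-loop coefficients; (AF-0r)∕(AF-0∞)∕(AF-1) for Bałaban's β; binder B3; Theorem 2; `BetaPertH`; continuum; Clay.
-/

namespace Summit.QuantumFields.BalabanUV.Beta.EriceFlowEnclosureB12AsPrintedPointwiseFadingLimitOneLoop

open Finset Filter Topology
open Literature.MathematicalPhysics.QuantumFieldTheory.Balaban1983to89
open Literature.MathematicalPhysics.QuantumFieldTheory.Balaban1983to89.B12BetaAsPrinted
open Literature.MathematicalPhysics.QuantumFieldTheory.Balaban1983to89.FlowStep (HBeta prefixOf Box mem_box box_mono RGEqH BetaUpperH)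
open Literature.MathematicalPhysics.QuantumFieldTheory.Balaban1983to89.T4CouplingMatching (HistLipschitz FadingMemory ScaleShiftRate
  EventualLowerH)
open Literature.MathematicalPhysics.QuantumFieldTheory.Balaban1983to89.T4BetaStationary (SeqBox betaInf constant_nonneg_of_scaleShiftRate)
open Summit.QuantumFields.BalabanUV.Beta.EriceFlowEnclosureB12AsPrintedTunedUpper (hrg_of_betaUpperH)
open Summit.QuantumFields.BalabanUV.Beta.EriceFlowEnclosureB12AsPrintedPointwiseFadingDrift (runs_of_theorem2)
open Summit.QuantumFields.BalabanUV.Beta.EriceFlowEnclosureB12AsPrintedPointwiseFadingLimit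
open Summit.QuantumFields.BalabanUV.Beta.EriceFlowEnclosureB12AsPrintedPointwiseFadingLimitFloors

noncomputable section

variable {β : HBeta} {γ C Cr c θ : ℝ} {Λ : ℕ → ℕ → ℝ}

/-! ## §1 The one-loop coefficients converge to `b⋆` at NE4's rate -/

/-- **The constant history read through the split**: with `T : OneLoopSplit β` and the corner bound `|β¹_{k+1}(p)| ≤ C_r·p_k` on ]0, γ]^{k+1}, for `0 < δ ≤ γ`:
`|β_{k+1}(δ,…,δ) − β⁰_{k+1}| ≤ C_r δ`. [cite: Balaban1987RG1, (2.12)–(2.14) p.268 with §1 p.264] -/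
theorem abs_const_sub_beta0_le (T : B12Beta.OneLoopSplit β)
    (hAF1 : ∀ (k : ℕ) (p : Fin (k + 1) → ℝ), p ∈ Box γ k → |T.β1 k p| ≤ Cr * p (Fin.last k))
    {δ : ℝ} (hδ : 0 < δ) (hδγ : δ ≤ γ) (k : ℕ) :
    |β k (fun _ : Fin (k + 1) => δ) - T.β0 k| ≤ Cr * δ := by
  have hconst : (fun _ : Fin (k + 1) => δ) ∈ Box γ k := mem_box.mpr fun _ => ⟨hδ, hδγ⟩
  have h := hAF1 k (fun _ => δ) hconst
  rw [T.split k (fun _ => δ)]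
  simpa using h

/-- **THE ONE-LOOP COEFFICIENTS CONVERGE TO THE ASYMPTOTIC CONSTANT AT NE4's RATE: `|β⁰_{k+1} − b⋆| ≤ cθ^k∕(1−θ)`.**  Node U2's moduli + NE4 (0 ≤ θ < 1, 0 ≤ C, 0 < γ), `b⋆` (`hb`), a split
`T : OneLoopSplit β` with the corner bound (AF-1) ⟹ for EVERY k, `|β⁰_{k+1} − b⋆| ≤ cθ^k∕(1−θ)`: at every `0 < δ ≤ γ`, `|β⁰_{k+1} − b⋆| ≤ C_rδ + 2Cδ∕(1−θ) + cθ^k∕(1−θ)` (part 11's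
`abs_beta_sub_bstar_le` on the constant history); δ → 0⁺ at fixed k.  This is (AF-0r) with the limit IDENTIFIED as `b⋆`. [cite: Balaban1987RG1, (2.12)–(2.14) p.268, §1 p.264, §5 p.298] -/
theorem abs_beta0_sub_bstar_le (hL : HistLipschitz Λ γ β) (hΛ : FadingMemory C θ Λ) (hS : ScaleShiftRate c θ γ β)
    (hθ0 : 0 ≤ θ) (hθ1 : θ < 1) (hC : 0 ≤ C) (hγ : 0 < γ) {bstar : ℝ}
    (hb : ∀ u : ℝ, 0 < u → u ≤ γ → |betaInf β (fun _ : ℕ => u) - bstar| ≤ C * u / (1 - θ))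
    (T : B12Beta.OneLoopSplit β)
    (hAF1 : ∀ (k : ℕ) (p : Fin (k + 1) → ℝ), p ∈ Box γ k → |T.β1 k p| ≤ Cr * p (Fin.last k)) (k : ℕ) :
    |T.β0 k - bstar| ≤ c * θ ^ k / (1 - θ) := by
  have h1θ : 0 < 1 - θ := by linarith
  -- C_r ≥ 0 (from the bound at the constant history γ)
  have hCr : 0 ≤ Cr := by
    have h := hAF1 0 (fun _ => γ) (mem_box.mpr fun _ => ⟨hγ, le_rfl⟩)
    have : 0 ≤ Cr * γ := (abs_nonneg _).trans h
    nlinarith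
  have hδ : ∀ δ : ℝ, 0 < δ → δ ≤ γ → |T.β0 k - bstar| ≤ (Cr + 2 * C / (1 - θ)) * δ + c * θ ^ k / (1 - θ) := by
    intro δ hδ hδγ
    have h1 := abs_const_sub_beta0_le T hAF1 hδ hδγ k
    have h2 := abs_beta_sub_bstar_le hL hΛ hS hθ0 hθ1 hC hb hδ hδγ (k := k) (v := fun _ => δ) (mem_box.mpr fun _ => ⟨hδ, le_rfl⟩)
    have htri : |T.β0 k - bstar| ≤ |β k (fun _ : Fin (k + 1) => δ) - T.β0 k| + |β k (fun _ : Fin (k + 1) => δ) - bstar| := by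
      rw [abs_sub_comm (β k _) (T.β0 k)]
      exact abs_sub_le (T.β0 k) (β k (fun _ : Fin (k + 1) => δ)) bstar
    have e : (Cr + 2 * C / (1 - θ)) * δ = Cr * δ + 2 * C * δ / (1 - θ) := by ring
    linarith
  refine le_of_forall_pos_le_add fun ε hε => ?_
  set A : ℝ := Cr + 2 * C / (1 - θ) with hA
  have hA0 : 0 ≤ A := by rw [hA]; positivity
  set δ : ℝ := min γ (ε / (A + 1)) with hδdef
  have hδ0 : 0 < δ := lt_min hγ (by positivity)
  have hδγ : δ ≤ γ := min_le_left _ _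
  have hAδ : A * δ ≤ ε := by
    have h1 : δ ≤ ε / (A + 1) := min_le_right _ _
    have h2 : (A + 1) * δ ≤ ε := by rwa [le_div_iff₀ (by positivity), mul_comm] at h1
    nlinarith [hδ0.le]
  linarith [hδ δ hδ0 hδγ]

/-- **`β⁰_{k+1} ⟶ b⋆`.** [cite: Balaban1987RG1, (2.12)–(2.14) p.268 with §5 p.298] -/
theorem tendsto_beta0_bstar (hL : HistLipschitz Λ γ β) (hΛ : FadingMemory C θ Λ) (hS : ScaleShiftRate c θ γ β)
    (hθ0 : 0 ≤ θ) (hθ1 : θ < 1) (hC : 0 ≤ C) (hγ : 0 < γ) {bstar : ℝ}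
    (hb : ∀ u : ℝ, 0 < u → u ≤ γ → |betaInf β (fun _ : ℕ => u) - bstar| ≤ C * u / (1 - θ))
    (T : B12Beta.OneLoopSplit β)
    (hAF1 : ∀ (k : ℕ) (p : Fin (k + 1) → ℝ), p ∈ Box γ k → |T.β1 k p| ≤ Cr * p (Fin.last k)) :
    Tendsto (fun k => T.β0 k) atTop (𝓝 bstar) := by
  have hrate : Tendsto (fun k : ℕ => c * θ ^ k / (1 - θ)) atTop (𝓝 (c * 0 / (1 - θ))) :=
    ((tendsto_pow_atTop_nhds_zero_of_lt_one hθ0 hθ1).const_mul c).div_const _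
  rw [mul_zero, zero_div] at hrate
  rw [Metric.tendsto_atTop]
  intro ε hε
  obtain ⟨k₀, hk₀⟩ := (Metric.tendsto_atTop.mp hrate) ε hε
  refine ⟨k₀, fun k hk => ?_⟩
  have h := hk₀ k hk
  rw [Real.dist_eq, sub_zero] at h
  rw [Real.dist_eq]
  exact lt_of_le_of_lt (abs_beta0_sub_bstar_le hL hΛ hS hθ0 hθ1 hC hγ hb T hAF1 k) (lt_of_abs_lt h)

/-- **ANY LIMIT OF THE ONE-LOOP COEFFICIENTS IS b⋆** — in particular the number «binf» of the gaps cell's `Spine/NE4/AsymptoticContent.conv_of_scaleShiftRate` (NE4 + corner bound ⟹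
`∃ binf, |β⁰_{k+1} − binf| ≤ (c∕(1−θ))θ^k`) coincides with part 11's asymptotic constant whenever node U2's moduli hold too. [folklore] -/
theorem limit_eq_bstar (hL : HistLipschitz Λ γ β) (hΛ : FadingMemory C θ Λ) (hS : ScaleShiftRate c θ γ β)
    (hθ0 : 0 ≤ θ) (hθ1 : θ < 1) (hC : 0 ≤ C) (hγ : 0 < γ) {bstar : ℝ}
    (hb : ∀ u : ℝ, 0 < u → u ≤ γ → |betaInf β (fun _ : ℕ => u) - bstar| ≤ C * u / (1 - θ))
    (T : B12Beta.OneLoopSplit β)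
    (hAF1 : ∀ (k : ℕ) (p : Fin (k + 1) → ℝ), p ∈ Box γ k → |T.β1 k p| ≤ Cr * p (Fin.last k))
    {binf : ℝ} (hlim : Tendsto (fun k => T.β0 k) atTop (𝓝 binf)) : binf = bstar :=
  tendsto_nhds_unique hlim (tendsto_beta0_bstar hL hΛ hS hθ0 hθ1 hC hγ hb T hAF1)

/-- With `b⋆ > 0` the one-loop coefficients are eventually ≥ b⋆∕2 (from the threshold `cθ^{k₀} ≤ (1−θ)b⋆∕2` on) — an (AF-0∞)-type eventual floor for β⁰, as a consequence. [folklore] -/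
theorem beta0_eventually_pos (hL : HistLipschitz Λ γ β) (hΛ : FadingMemory C θ Λ) (hS : ScaleShiftRate c θ γ β)
    (hθ0 : 0 ≤ θ) (hθ1 : θ < 1) (hC : 0 ≤ C) (hγ : 0 < γ) {bstar : ℝ}
    (hb : ∀ u : ℝ, 0 < u → u ≤ γ → |betaInf β (fun _ : ℕ => u) - bstar| ≤ C * u / (1 - θ))
    (T : B12Beta.OneLoopSplit β)
    (hAF1 : ∀ (k : ℕ) (p : Fin (k + 1) → ℝ), p ∈ Box γ k → |T.β1 k p| ≤ Cr * p (Fin.last k))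
    {k₀ : ℕ} (hk₀ : c * θ ^ k₀ ≤ (1 - θ) * bstar / 2) {k : ℕ} (hk : k₀ ≤ k) : bstar / 2 ≤ T.β0 k := by
  have h1θ : 0 < 1 - θ := by linarith
  have hc : 0 ≤ c := constant_nonneg_of_scaleShiftRate hS hγ
  have h := (abs_le.mp (abs_beta0_sub_bstar_le hL hΛ hS hθ0 hθ1 hC hγ hb T hAF1 k)).1
  have hθk : c * θ ^ k ≤ c * θ ^ k₀ := mul_le_mul_of_nonneg_left (pow_le_pow_of_le_one hθ0 hθ1.le hk) hc
  have hdiv : c * θ ^ k / (1 - θ) ≤ bstar / 2 := by rw [div_le_iff₀ h1θ]; linarith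
  linarith

/-! ## §2 On the as-printed carrier: the ONE BIT of the gaps cell's reduction from Theorem 2 AS TYPED -/

variable {S : Setting}

/-- **THE ONE BIT FROM THEOREM 2 AS TYPED.**  `Theorem2Statement S hL` AS TYPED + prover 1's `hrg` + node U2's letters `HistLipschitz Λ γ_U S.β` ∕ `FadingMemory C θ Λ` ∕ `ScaleShiftRate c θ γ_U S.β`
(0 ≤ θ < 1) + `b⋆` + ANY printed-type split `T : OneLoopSplit S.β` with the corner bound (AF-1) on ]0, γ_U] ⟹ the one-loop coefficients CONVERGE, `β⁰_{k+1} → b⋆`, and their limit is POSITIVE,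
`0 < b⋆` — the sign bit «`0 < lim_k β⁰_k`» of the gaps cell's `Spine/NE4/LimitFormFromNE4` (their `limPos_of_tendsto` converts this pair into their spelling), here a CONSEQUENCE of the typed
(0.31) (part 11c `bstar_pos_of_typedTheorem2` ∕ part 11a′ `bstar_pos_of_runs`). [cite: Balaban1987RG1, Thm 2 (0.31) p.259, (2.12)–(2.14) p.268, §1 p.264, §5 p.298] -/
theorem oneBit_of_typedTheorem2 {hL : Odd S.L ∧ 1 < S.L} (hT : Theorem2Statement S hL)
    {γU C Cr c θ : ℝ} {Λ : ℕ → ℕ → ℝ} (hγU : 0 < γU) (hθ0 : 0 ≤ θ) (hθ1 : θ < 1) (hC : 0 ≤ C)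
    (hrg : ∀ P : B12.RunParams, Step.InInterval γU P.K (S.cpl P) → RGEqH P.K S.β (S.cpl P))
    (hLip : HistLipschitz Λ γU S.β) (hΛ : FadingMemory C θ Λ) (hS : ScaleShiftRate c θ γU S.β) {bstar : ℝ}
    (hb : ∀ u : ℝ, 0 < u → u ≤ γU → |betaInf S.β (fun _ : ℕ => u) - bstar| ≤ C * u / (1 - θ))
    (T : B12Beta.OneLoopSplit S.β)
    (hAF1 : ∀ (k : ℕ) (p : Fin (k + 1) → ℝ), p ∈ Box γU k → |T.β1 k p| ≤ Cr * p (Fin.last k)) :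
    Tendsto (fun k => T.β0 k) atTop (𝓝 bstar) ∧ 0 < bstar := by
  obtain ⟨s, s', hs, -, hruns⟩ := runs_of_theorem2 hT hγU hrg
  exact ⟨tendsto_beta0_bstar hLip hΛ hS hθ0 hθ1 hC hγU hb T hAF1,
    bstar_pos_of_runs hLip hΛ hS hθ0 hθ1 hC hγU hb hs hruns⟩

/-- The same with `hrg` DISCHARGED from the printed `Definitions` and the upper letter (U) with `Mγ_U² < 1`. [cite: Balaban1987RG1, Thm 2 (0.31) p.259 with §1 p.264] -/
theorem oneBit_of_typedTheorem2' {hL : Odd S.L ∧ 1 < S.L} (hT : Theorem2Statement S hL) (hDef : Definitions S)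
    {γU C Cr c θ M : ℝ} {Λ : ℕ → ℕ → ℝ} (hγU : 0 < γU) (hθ0 : 0 ≤ θ) (hθ1 : θ < 1) (hC : 0 ≤ C)
    (hub : BetaUpperH M γU S.β) (hMγ : M * γU ^ 2 < 1)
    (hLip : HistLipschitz Λ γU S.β) (hΛ : FadingMemory C θ Λ) (hS : ScaleShiftRate c θ γU S.β) {bstar : ℝ}
    (hb : ∀ u : ℝ, 0 < u → u ≤ γU → |betaInf S.β (fun _ : ℕ => u) - bstar| ≤ C * u / (1 - θ))
    (T : B12Beta.OneLoopSplit S.β)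
    (hAF1 : ∀ (k : ℕ) (p : Fin (k + 1) → ℝ), p ∈ Box γU k → |T.β1 k p| ≤ Cr * p (Fin.last k)) :
    Tendsto (fun k => T.β0 k) atTop (𝓝 bstar) ∧ 0 < bstar :=
  oneBit_of_typedTheorem2 hT hγU hθ0 hθ1 hC (hrg_of_betaUpperH hDef hγU hub hMγ) hLip hΛ hS hb T hAF1

end

end Summit.QuantumFields.BalabanUV.Beta.EriceFlowEnclosureB12AsPrintedPointwiseFadingLimitOneLoop
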